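import Summits.AtomisticToContinuum.Crystallization.Theorems.ChartedPlanarOrderTubeChannelsRef

/-!
# The Lipschitz TAIL leaf of the channel split, PROVED with an explicit constant slot (decomp-a2c lens-3 g24, task (z))

(x) `…TubeChannels` reduced slot 7c′ᶜ `TubeConvexityW' (17/16) (1/40)` to CH ⟸ CHᴬ `AdjacentChannelW'` [CERT] ∧ CHꜰ `FarChannelBelowW' … s₀`
[CERT] ∧ TAIL `PairModulusTailW' … s₀ B₂` [ANALYTIC] ∧ arithmetic, and (y) `…TubeChannelsRef` typed the reference-centred twins.  This file
PROVES THE TAIL LEAF in both currencies from a POWER-LAW pair modulus `τ s = K · s⁻⁶` with ONE explicit constant slot `K`: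

* §1 `isPairModulus_mono`; the uniform planar floor `qFloor` (`≤ qA a b, qB a b` on the clean stacked window of
  `…StackedUniform.stackedUniform`: `‖a‖ ≥ 27/32`, `|‖b‖ − ‖a‖| ≤ ‖a‖/7`, Gram `≥ 24704/83521·‖a‖⁴`, `‖a‖, ‖b‖ ≤ 17/16`) and the antitonicity
  of (v)'s `spanConst θ q₁ q₂` in `q₁, q₂` ⇒ the UNIFORM constant `tailConst ρ := spanConst (19/50 − ρ) qFloor qFloor`.
* §2 the tail arithmetic `Σ_{s₀ ≤ s < N} s² · (K s⁻⁶) ≤ K / (3 (s₀ − 1)³)` for `s₀ ≥ 2` (telescoping `s⁻⁴ ≤ 1/(3(s−1)³) − 1/(3s³)`).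
* §3 `PowerPairModulusW' Λ ρ K` / `PowerPairModulusRef Λ₁ ρ K` (binder lists of `TubeConvexW'` / `TubeConvexRef` verbatim → `IsPairModulus a b w ρ
  (fun s => K * s⁻¹ ^ 6)`) and ★★ `powerPairModulusW'_of_le`, `powerPairModulusRef_of_le : Λ ≤ 17/16 → ρ < 19/50 → PowerPairModulus… Λ ρ (tailConst ρ)`
  ((v) `isPairModulus_of_heightFloor` at the floor `19/50` + the uniform `q`-floor).
* §4 ★★ THE TAIL LEAF: `pairModulusTailW'_of_power : 0 ≤ K → 2 ≤ s₀ → PowerPairModulusW' Λ ρ K → PairModulusTailW' Λ ρ s₀ (K / (3 (s₀ − 1)³))`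
  (+ Ref twin) and UNCONDITIONALLY IN RANGE `pairModulusTailW'_of_le`, `pairModulusTailRef_of_le : Λ ≤ 17/16 → ρ < 19/50 → 2 ≤ s₀ →
  PairModulusTail… Λ ρ s₀ (tailConst ρ / (3 (s₀ − 1)³))`.
* §5 CONSEQUENCE OF RECORD: slot 7c′ / 7c‴ at `(17/16, 1/40)` from the TWO CERT leaves + a power constant `K` + arithmetic
  (`tubeConvexW'_record_of_certs`, `tubeConvexRef_record_of_certs`; parametric in `K` so that a SHARPENED constant drops in), and with the
  as-typed constant `tailConst (1/40)` (`tubeConvexW'_record_of_certs₀`, `tubeConvexRef_record_of_certs₀`); the RDEF cones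
  `rdef_of_grossU_shape_gluing_pinning_certs_record` (W′) / `…_certsRef_record` (Ref).

NUMBERS (memo §13, STATUS note): the as-typed `tailConst (1/40) ≈ 4·10¹⁰` is worst-case by `≈ 10⁹` against the measured law `τ_s ≈ 28.5 s⁻⁶`
(census TAG 161b); the parametric slot `K` is where lens-3 g25's «TAIL CONSTANT» sharpening (`K ≤ 300`) enters — nothing else in the chain changes.

All proofs sorry-free, standard axioms; no instances, no notation.
-/

noncomputable section

namespace Summit.AtomisticToContinuum.Crystallization.Theorems.ChartedPlanarOrderPairModulusTail

open Finset
open scoped RealInnerProductSpace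
open Summit.AtomisticToContinuum.Crystallization.Theorems.ChartedPlanarOrderChunkFloor (E3)
open Summit.AtomisticToContinuum.Crystallization.Theorems.ChartedPlanarOrderProfileSlavingLJ (IsStacked gapStress incr tube offsetOf layerForce)
open Summit.AtomisticToContinuum.Crystallization.Theorems.ChartedPlanarOrderTubeMonotoneSplit (IsPairModulus)
open Summit.AtomisticToContinuum.Crystallization.Theorems.OverbindingBudgetElasticSplitShear (StressFree)
open Summit.AtomisticToContinuum.Crystallization.Theorems.ChartedPlanarOrderRigidityDoor (IsNash)
open Summit.AtomisticToContinuum.Crystallization.Theorems.ChartedPlanarOrderDensityDichotomy (μS IsSep)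
open Summit.AtomisticToContinuum.Crystallization.Theorems.ChartedPlanarOrderDoorLayered (Layered)
open Summit.AtomisticToContinuum.Crystallization.Theorems.OverbindingBudgetScaleWidening (IsCleanW)
open Summit.AtomisticToContinuum.Crystallization.Theorems.OverbindingBudgetPeriodicCleanOrStrained (UniformlyClean)
open Summit.AtomisticToContinuum.Crystallization.Theorems.ChartedPlanarOrderStackedUniform (stackedUniform)
open Summit.AtomisticToContinuum.Crystallization.Theorems.ChartedPlanarOrderCleanScaleP (linearIndependent_of_cleanP_stacked)
open Summit.AtomisticToContinuum.Crystallization.Theorems.ChartedPlanarOrderPairModulus (qA qB spanConst spanConst_nonneg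
  isPairModulus_of_heightFloor)
open Summit.AtomisticToContinuum.Crystallization.Theorems.ChartedPlanarOrderTubeConvex (TubeConvexW' TubeConvexRef)
open Summit.AtomisticToContinuum.Crystallization.Theorems.ChartedPlanarOrderTubeChannels (AdjacentChannelW' FarChannelBelowW' PairModulusTailW'
  tubeConvexW'_record_of_leaves)
open Summit.AtomisticToContinuum.Crystallization.Theorems.ChartedPlanarOrderTubeChannelsRef (AdjacentChannelRef FarChannelBelowRef
  PairModulusTailRef tubeConvexRef_record_of_leaves)

/-! ## §1 Monotonicity of pair moduli, the uniform planar floor and the uniform tail constant -/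

/-- a pair modulus stays one under a pointwise larger modulus. [folklore] -/
theorem isPairModulus_mono {a b : E3} {w : ℤ → E3} {η : ℝ} {τ τ' : ℕ → ℝ} (hle : ∀ s, τ s ≤ τ' s) (h : IsPairModulus a b w η τ) :
    IsPairModulus a b w η τ' :=
  fun k l hkl f f' hf hf' => (h k l hkl f f' hf hf').trans (mul_le_mul_of_nonneg_right (hle _) (norm_nonneg _))

/-- (v)'s span constant is antitone in the planar floors `q₁, q₂ ≥ q₀ > 0`. [folklore] -/
theorem spanConst_le_of_le {θ q₀ q₁ q₂ : ℝ} (hq₀ : 0 < q₀) (h₁ : q₀ ≤ q₁) (h₂ : q₀ ≤ q₂) :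
    spanConst θ q₁ q₂ ≤ spanConst θ q₀ q₀ := by
  have e₁ : q₁⁻¹ ^ 2 ≤ q₀⁻¹ ^ 2 := pow_le_pow_left₀ (inv_nonneg.2 (hq₀.le.trans h₁)) (inv_anti₀ hq₀ h₁) 2
  have e₂ : q₂⁻¹ ^ 2 ≤ q₀⁻¹ ^ 2 := pow_le_pow_left₀ (inv_nonneg.2 (hq₀.le.trans h₂)) (inv_anti₀ hq₀ h₂) 2
  unfold spanConst
  gcongr

/-- the uniform planar floor on the clean stacked window: `qFloor = (24704/83521)·(27/32)⁴ / (17/16)² / 2 ≈ 0.0664`. -/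
def qFloor : ℝ := 24704 / 83521 * (27 / 32) ^ 4 / (17 / 16) ^ 2 / 2

/-- `qFloor` is positive. [folklore] -/
theorem qFloor_pos : 0 < qFloor := by unfold qFloor; norm_num

/-- `qFloor ≤ qA a b` on the clean stacked window. -/
theorem qFloor_le_qA {a b : E3} (ha : 27 / 32 ≤ ‖a‖) (hb : ‖b‖ ≤ 17 / 16) (hb0 : 0 < ‖b‖)
    (hG : 24704 / 83521 * ‖a‖ ^ 4 ≤ ‖a‖ ^ 2 * ‖b‖ ^ 2 - ⟪a, b⟫ ^ 2) : qFloor ≤ qA a b := by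
  have h1 : ‖b‖ ^ 2 ≤ (17 / 16) ^ 2 := pow_le_pow_left₀ (norm_nonneg _) hb 2
  have h2 : (27 / 32 : ℝ) ^ 4 ≤ ‖a‖ ^ 4 := pow_le_pow_left₀ (by norm_num) ha 4
  unfold qA qFloor
  rw [le_div_iff₀ two_pos, le_div_iff₀ (by positivity)]
  nlinarith [h1, h2, hG, sq_nonneg ‖b‖]

/-- `qFloor ≤ qB a b` on the clean stacked window. -/
theorem qFloor_le_qB {a b : E3} (ha : 27 / 32 ≤ ‖a‖) (ha' : ‖a‖ ≤ 17 / 16)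
    (hG : 24704 / 83521 * ‖a‖ ^ 4 ≤ ‖a‖ ^ 2 * ‖b‖ ^ 2 - ⟪a, b⟫ ^ 2) : qFloor ≤ qB a b := by
  have h1 : ‖a‖ ^ 2 ≤ (17 / 16) ^ 2 := pow_le_pow_left₀ (norm_nonneg _) ha' 2
  have h2 : (27 / 32 : ℝ) ^ 4 ≤ ‖a‖ ^ 4 := pow_le_pow_left₀ (by norm_num) ha 4
  have ha0 : 0 < ‖a‖ := by linarith
  unfold qB qFloor
  rw [le_div_iff₀ two_pos, le_div_iff₀ (by positivity)]
  nlinarith [h1, h2, hG, sq_nonneg ‖a‖]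

/-- the UNIFORM tail constant on the `ρ`-tube: `tailConst ρ = spanConst (19/50 − ρ) qFloor qFloor`. -/
def tailConst (ρ : ℝ) : ℝ := spanConst (19 / 50 - ρ) qFloor qFloor

/-- `tailConst` is nonnegative. [folklore] -/
theorem tailConst_nonneg (ρ : ℝ) : 0 ≤ tailConst ρ := spanConst_nonneg _ _ _

/-! ## §2 The tail arithmetic `Σ_{s₀ ≤ s < N} s²·(K s⁻⁶) ≤ K / (3 (s₀ − 1)³)` -/

/-- the telescoping step `x⁻⁴ ≤ 1/(3(x−1)³) − 1/(3x³)` for `x ≥ 2` (numerator `6x² − 8x + 3 > 0`). -/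
theorem inv_pow_four_le_telescope {x : ℝ} (hx : 2 ≤ x) : 1 / x ^ 4 ≤ 1 / (3 * (x - 1) ^ 3) - 1 / (3 * x ^ 3) := by
  have hx0 : 0 < x := by linarith
  have hx1 : 0 < x - 1 := by linarith
  have hden : 0 < 3 * x ^ 4 * (x - 1) ^ 3 := mul_pos (mul_pos three_pos (pow_pos hx0 4)) (pow_pos hx1 3)
  rw [← sub_nonneg]
  have e : 1 / (3 * (x - 1) ^ 3) - 1 / (3 * x ^ 3) - 1 / x ^ 4 = (6 * x ^ 2 - 8 * x + 3) / (3 * x ^ 4 * (x - 1) ^ 3) := by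
    field_simp
    ring
  rw [e]
  exact div_nonneg (by nlinarith) hden.le

/-- the summand `s² · (K s⁻⁶) = K / s⁴` for `s ≠ 0`. -/
theorem sq_mul_power_eq {K : ℝ} {s : ℕ} (hs : s ≠ 0) : ((s : ℕ) : ℝ) ^ 2 * (K * ((s : ℕ) : ℝ)⁻¹ ^ 6) = K * (1 / ((s : ℕ) : ℝ) ^ 4) := by
  have hs' : ((s : ℕ) : ℝ) ≠ 0 := by exact_mod_cast hs
  field_simp

/-- telescoped partial sums: `Σ_{s₀ ≤ s < s₀ + n} s²·(K s⁻⁶) ≤ K·(1/(3(s₀−1)³) − 1/(3(s₀+n−1)³))` for `s₀ ≥ 2`, `K ≥ 0`. -/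
theorem sum_Ico_sq_mul_power_le_aux {K : ℝ} (hK : 0 ≤ K) {s₀ : ℕ} (hs₀ : 2 ≤ s₀) (n : ℕ) :
    ∑ s ∈ Finset.Ico s₀ (s₀ + n), ((s : ℕ) : ℝ) ^ 2 * (K * ((s : ℕ) : ℝ)⁻¹ ^ 6) ≤
      K * (1 / (3 * (((s₀ : ℕ) : ℝ) - 1) ^ 3) - 1 / (3 * ((((s₀ + n : ℕ) : ℕ) : ℝ) - 1) ^ 3)) := by
  induction n with
  | zero => simp
  | succ n ih =>
    rw [← add_assoc, Finset.sum_Ico_succ_top (Nat.le_add_right _ _), ]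
    have hs : s₀ + n ≠ 0 := by omega
    have hx : (2 : ℝ) ≤ ((s₀ + n : ℕ) : ℝ) := by exact_mod_cast (hs₀.trans (Nat.le_add_right _ _))
    have step := inv_pow_four_le_telescope hx
    rw [sq_mul_power_eq hs]
    have e : (((s₀ + n + 1 : ℕ) : ℕ) : ℝ) - 1 = ((s₀ + n : ℕ) : ℝ) := by push_cast; ring
    rw [e]
    have := mul_le_mul_of_nonneg_left step hK
    linarith [ih, this]

/-- ★ the TAIL ARITHMETIC: `Σ_{s₀ ≤ s < N} s²·(K s⁻⁶) ≤ K / (3 (s₀ − 1)³)` for every `N`, when `s₀ ≥ 2`, `K ≥ 0`. -/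
theorem sum_Ico_sq_mul_power_le {K : ℝ} (hK : 0 ≤ K) {s₀ : ℕ} (hs₀ : 2 ≤ s₀) (N : ℕ) :
    ∑ s ∈ Finset.Ico s₀ N, ((s : ℕ) : ℝ) ^ 2 * (K * ((s : ℕ) : ℝ)⁻¹ ^ 6) ≤ K / (3 * (((s₀ : ℕ) : ℝ) - 1) ^ 3) := by
  have h1 : (1 : ℝ) ≤ ((s₀ : ℕ) : ℝ) - 1 := by
    have : (2 : ℝ) ≤ ((s₀ : ℕ) : ℝ) := by exact_mod_cast hs₀
    linarith
  rcases le_or_gt N s₀ with hN | hN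
  · rw [Finset.Ico_eq_empty (not_lt.2 hN), Finset.sum_empty]
    exact div_nonneg hK (by positivity)
  · obtain ⟨n, rfl⟩ := Nat.exists_eq_add_of_lt hN
    have h := sum_Ico_sq_mul_power_le_aux hK hs₀ (n + 1)
    have hpos : 0 ≤ 1 / (3 * ((((s₀ + (n + 1) : ℕ) : ℕ) : ℝ) - 1) ^ 3) := by
      have : (2 : ℝ) ≤ (((s₀ + (n + 1) : ℕ) : ℕ) : ℝ) := by exact_mod_cast (hs₀.trans (Nat.le_add_right _ _))
      have : 0 < (((s₀ + (n + 1) : ℕ) : ℕ) : ℝ) - 1 := by linarith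
      positivity
    rw [show s₀ + n + 1 = s₀ + (n + 1) by ring]
    calc _ ≤ _ := h
      _ ≤ K * (1 / (3 * (((s₀ : ℕ) : ℝ) - 1) ^ 3)) := by nlinarith
      _ = K / (3 * (((s₀ : ℕ) : ℝ) - 1) ^ 3) := by rw [mul_one_div]

/-! ## §3 Power-law pair moduli at the W′ and Ref levels, PROVED in range with the uniform constant -/

/-- **`PowerPairModulusW' Λ ρ K`** — on every clean stacked W′ configuration (`TubeConvexW'`'s binder list verbatim) the layer-pair forces are
`K s⁻⁶`-Lipschitz along the `ρ`-tube. [ANALYTIC · the constant slot of the TAIL leaf] -/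
def PowerPairModulusW' (Λ ρ K : ℝ) : Prop :=
  ∀ δ : ℝ, 0 < δ → ∀ (a b : E3) (w : ℤ → E3), ‖a‖ ≤ Λ → ‖b‖ ≤ Λ →
    IsSep δ (Layered a b w) → IsCleanW (μS (Layered a b w)) → IsNash (μS (Layered a b w)) → IsStacked a b w →
    StressFree (Layered a b w) → (∀ m : ℤ, gapStress a b m (incr w) = 0) →
    IsPairModulus a b w ρ (fun s => K * ((s : ℕ) : ℝ)⁻¹ ^ 6)

/-- **`PowerPairModulusRef Λ₁ ρ K`** — the same round every uniformly clean zero-gap-stress stacked reference (`TubeConvexRef`'s binder list). -/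
def PowerPairModulusRef (Λ₁ ρ K : ℝ) : Prop :=
  ∀ δ : ℝ, 0 < δ → ∀ (a b : E3) (w' : ℤ → E3), IsStacked a b w' → LinearIndependent ℝ ![a, b] → ‖a‖ ≤ Λ₁ → ‖b‖ ≤ Λ₁ →
    IsSep δ (Layered a b w') → IsCleanW (μS (Layered a b w')) → (∀ m : ℤ, gapStress a b m (incr w') = 0) →
    UniformlyClean (Layered a b w') →
    IsPairModulus a b w' ρ (fun s => K * ((s : ℕ) : ℝ)⁻¹ ^ 6)

/-- ★ configuration level: a `δ`-separated `IsCleanW` stacked configuration with `‖a‖, ‖b‖ ≤ 17/16` has the power-law pair modulus with the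
UNIFORM constant `tailConst ρ` on every `ρ`-tube, `ρ < 19/50` ((v) at the height floor `19/50` of `stackedUniform`, uniform `q`-floor). -/
theorem isPairModulus_tailConst {ρ δ : ℝ} (hρ : ρ < 19 / 50) (hδ : 0 < δ) {a b : E3} {w : ℤ → E3} (hs : IsSep δ (Layered a b w))
    (hc : IsCleanW (μS (Layered a b w))) (hst : IsStacked a b w) (ha : ‖a‖ ≤ 17 / 16) (hb : ‖b‖ ≤ 17 / 16) :
    IsPairModulus a b w ρ (fun s => tailConst ρ * ((s : ℕ) : ℝ)⁻¹ ^ 6) := by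
  obtain ⟨ν, hν1, hνa, hνb, -, ha27, hba, hG, hTS⟩ := stackedUniform (aHi := 103 / 100) (by norm_num) hδ hs hc hst ha hb
  have hab : LinearIndependent ℝ ![a, b] := linearIndependent_of_cleanP_stacked (aHi := 103 / 100) (by norm_num) hδ hs hc hst
  have hw : ∀ i, (19 / 50 : ℝ) ≤ ⟪ν, incr w i⟫ := fun i => by
    have e : incr w i = w (i - 1 + 1) - w (i - 1) := by rw [sub_add_cancel]; rfl
    rw [e]
    rcases hTS with ⟨-, hT⟩ | ⟨-, hS⟩
    · have h := (hT (i - 1)).1; nlinarith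
    · have h := (hS (i - 1)).1; nlinarith
  have hb0 : 0 < ‖b‖ := by
    have := abs_le.1 hba
    nlinarith
  have hP := isPairModulus_of_heightFloor hν1 hνa hνb hab hw hρ
  refine isPairModulus_mono (fun s => ?_) hP
  exact mul_le_mul_of_nonneg_right (spanConst_le_of_le qFloor_pos (qFloor_le_qA ha27 hb hb0 hG) (qFloor_le_qB ha27 ha hG))
    (by positivity)

/-- ★★ `PowerPairModulusW' Λ ρ (tailConst ρ)` for `Λ ≤ 17/16`, `ρ < 19/50`. -/
theorem powerPairModulusW'_of_le {Λ ρ : ℝ} (hΛ : Λ ≤ 17 / 16) (hρ : ρ < 19 / 50) : PowerPairModulusW' Λ ρ (tailConst ρ) :=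
  fun _ hδ _ _ _ ha hb hs hc _ hst _ _ => isPairModulus_tailConst hρ hδ hs hc hst (ha.trans hΛ) (hb.trans hΛ)

/-- ★★ `PowerPairModulusRef Λ₁ ρ (tailConst ρ)` for `Λ₁ ≤ 17/16`, `ρ < 19/50`. -/
theorem powerPairModulusRef_of_le {Λ₁ ρ : ℝ} (hΛ : Λ₁ ≤ 17 / 16) (hρ : ρ < 19 / 50) : PowerPairModulusRef Λ₁ ρ (tailConst ρ) :=
  fun _ hδ _ _ _ hst _ ha hb hs hc _ _ => isPairModulus_tailConst hρ hδ hs hc hst (ha.trans hΛ) (hb.trans hΛ)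

/-! ## §4 ★★ The TAIL leaf, proved -/

/-- ★★ TAIL-W′ from a power constant: `PowerPairModulusW' Λ ρ K → PairModulusTailW' Λ ρ s₀ (K / (3 (s₀ − 1)³))` (`K ≥ 0`, `s₀ ≥ 2`). -/
theorem pairModulusTailW'_of_power {Λ ρ K : ℝ} {s₀ : ℕ} (hK : 0 ≤ K) (hs₀ : 2 ≤ s₀) (h : PowerPairModulusW' Λ ρ K) :
    PairModulusTailW' Λ ρ s₀ (K / (3 * (((s₀ : ℕ) : ℝ) - 1) ^ 3)) :=
  fun δ hδ a b w ha hb hs hc hn hst hsf hz =>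
    ⟨fun s => K * ((s : ℕ) : ℝ)⁻¹ ^ 6, fun s => by positivity, fun N => sum_Ico_sq_mul_power_le hK hs₀ N,
      h δ hδ a b w ha hb hs hc hn hst hsf hz⟩

/-- ★★ TAIL-Ref from a power constant. -/
theorem pairModulusTailRef_of_power {Λ₁ ρ K : ℝ} {s₀ : ℕ} (hK : 0 ≤ K) (hs₀ : 2 ≤ s₀) (h : PowerPairModulusRef Λ₁ ρ K) :
    PairModulusTailRef Λ₁ ρ s₀ (K / (3 * (((s₀ : ℕ) : ℝ) - 1) ^ 3)) :=
  fun δ hδ a b w' hst hab ha hb hs hc hz hUC =>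
    ⟨fun s => K * ((s : ℕ) : ℝ)⁻¹ ^ 6, fun s => by positivity, fun N => sum_Ico_sq_mul_power_le hK hs₀ N,
      h δ hδ a b w' hst hab ha hb hs hc hz hUC⟩

/-- ★★ THE TAIL LEAF HOLDS (W′): `PairModulusTailW' Λ ρ s₀ (tailConst ρ / (3 (s₀ − 1)³))` for `Λ ≤ 17/16`, `ρ < 19/50`, `s₀ ≥ 2`. -/
theorem pairModulusTailW'_of_le {Λ ρ : ℝ} {s₀ : ℕ} (hΛ : Λ ≤ 17 / 16) (hρ : ρ < 19 / 50) (hs₀ : 2 ≤ s₀) :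
    PairModulusTailW' Λ ρ s₀ (tailConst ρ / (3 * (((s₀ : ℕ) : ℝ) - 1) ^ 3)) :=
  pairModulusTailW'_of_power (tailConst_nonneg ρ) hs₀ (powerPairModulusW'_of_le hΛ hρ)

/-- ★★ THE TAIL LEAF HOLDS (Ref). -/
theorem pairModulusTailRef_of_le {Λ₁ ρ : ℝ} {s₀ : ℕ} (hΛ : Λ₁ ≤ 17 / 16) (hρ : ρ < 19 / 50) (hs₀ : 2 ≤ s₀) :
    PairModulusTailRef Λ₁ ρ s₀ (tailConst ρ / (3 * (((s₀ : ℕ) : ℝ) - 1) ^ 3)) :=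
  pairModulusTailRef_of_power (tailConst_nonneg ρ) hs₀ (powerPairModulusRef_of_le hΛ hρ)

/-! ## §5 Slot 7c′ / 7c‴ of record from the TWO certificate leaves, a power constant and arithmetic -/

/-- ★★ 7c′ of record from CHᴬ-W′ + CHꜰ-W′ below `s₀` + a power constant `K` + the channel arithmetic with the tail budget `K/(3(s₀−1)³)`. -/
theorem tubeConvexW'_record_of_certs {lT lN lam B₁T B₁N K : ℝ} {μT μN : ℕ → ℝ} {s₀ : ℕ}
    (hA : AdjacentChannelW' (17 / 16) (1 / 40) lT lN) (hB : FarChannelBelowW' (17 / 16) (1 / 40) μT μN s₀)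
    (hP : PowerPairModulusW' (17 / 16) (1 / 40) K) (hK : 0 ≤ K) (hs₀ : 2 ≤ s₀) (hμT : ∀ s, 0 ≤ μT s) (hμN : ∀ s, 0 ≤ μN s)
    (h₁T : ∑ s ∈ Finset.Ico 2 s₀, ((s : ℕ) : ℝ) ^ 2 * μT s ≤ B₁T) (h₁N : ∑ s ∈ Finset.Ico 2 s₀, ((s : ℕ) : ℝ) ^ 2 * μN s ≤ B₁N)
    (hlam : 0 < lam) (hlamT : lam + (B₁T + K / (3 * (((s₀ : ℕ) : ℝ) - 1) ^ 3)) ≤ lT)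
    (hlamN : lam + (B₁N + K / (3 * (((s₀ : ℕ) : ℝ) - 1) ^ 3)) ≤ lN) : TubeConvexW' (17 / 16) (1 / 40) :=
  tubeConvexW'_record_of_leaves hA hB (pairModulusTailW'_of_power hK hs₀ hP) hμT hμN h₁T h₁N hlam hlamT hlamN

/-- ★ 7c′ of record from the two certificate leaves with the AS-TYPED tail constant `tailConst (1/40)`. -/
theorem tubeConvexW'_record_of_certs₀ {lT lN lam B₁T B₁N : ℝ} {μT μN : ℕ → ℝ} {s₀ : ℕ}
    (hA : AdjacentChannelW' (17 / 16) (1 / 40) lT lN) (hB : FarChannelBelowW' (17 / 16) (1 / 40) μT μN s₀) (hs₀ : 2 ≤ s₀)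
    (hμT : ∀ s, 0 ≤ μT s) (hμN : ∀ s, 0 ≤ μN s)
    (h₁T : ∑ s ∈ Finset.Ico 2 s₀, ((s : ℕ) : ℝ) ^ 2 * μT s ≤ B₁T) (h₁N : ∑ s ∈ Finset.Ico 2 s₀, ((s : ℕ) : ℝ) ^ 2 * μN s ≤ B₁N)
    (hlam : 0 < lam) (hlamT : lam + (B₁T + tailConst (1 / 40) / (3 * (((s₀ : ℕ) : ℝ) - 1) ^ 3)) ≤ lT)
    (hlamN : lam + (B₁N + tailConst (1 / 40) / (3 * (((s₀ : ℕ) : ℝ) - 1) ^ 3)) ≤ lN) : TubeConvexW' (17 / 16) (1 / 40) :=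
  tubeConvexW'_record_of_certs hA hB (powerPairModulusW'_of_le le_rfl (by norm_num)) (tailConst_nonneg _) hs₀ hμT hμN h₁T h₁N hlam
    hlamT hlamN

/-- ★★ 7c‴ of record (Ref currency) from CHᴬ-Ref + CHꜰ-Ref below `s₀` + a power constant `K` + arithmetic. -/
theorem tubeConvexRef_record_of_certs {lT lN lam B₁T B₁N K : ℝ} {μT μN : ℕ → ℝ} {s₀ : ℕ}
    (hA : AdjacentChannelRef (17 / 16) (1 / 40) lT lN) (hB : FarChannelBelowRef (17 / 16) (1 / 40) μT μN s₀)
    (hP : PowerPairModulusRef (17 / 16) (1 / 40) K) (hK : 0 ≤ K) (hs₀ : 2 ≤ s₀) (hμT : ∀ s, 0 ≤ μT s) (hμN : ∀ s, 0 ≤ μN s)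
    (h₁T : ∑ s ∈ Finset.Ico 2 s₀, ((s : ℕ) : ℝ) ^ 2 * μT s ≤ B₁T) (h₁N : ∑ s ∈ Finset.Ico 2 s₀, ((s : ℕ) : ℝ) ^ 2 * μN s ≤ B₁N)
    (hlam : 0 < lam) (hlamT : lam + (B₁T + K / (3 * (((s₀ : ℕ) : ℝ) - 1) ^ 3)) ≤ lT)
    (hlamN : lam + (B₁N + K / (3 * (((s₀ : ℕ) : ℝ) - 1) ^ 3)) ≤ lN) : TubeConvexRef (17 / 16) (1 / 40) :=
  tubeConvexRef_record_of_leaves hA hB (pairModulusTailRef_of_power hK hs₀ hP) hμT hμN h₁T h₁N hlam hlamT hlamN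

/-- ★ 7c‴ of record from the two Ref certificate leaves with the as-typed tail constant. -/
theorem tubeConvexRef_record_of_certs₀ {lT lN lam B₁T B₁N : ℝ} {μT μN : ℕ → ℝ} {s₀ : ℕ}
    (hA : AdjacentChannelRef (17 / 16) (1 / 40) lT lN) (hB : FarChannelBelowRef (17 / 16) (1 / 40) μT μN s₀) (hs₀ : 2 ≤ s₀)
    (hμT : ∀ s, 0 ≤ μT s) (hμN : ∀ s, 0 ≤ μN s)
    (h₁T : ∑ s ∈ Finset.Ico 2 s₀, ((s : ℕ) : ℝ) ^ 2 * μT s ≤ B₁T) (h₁N : ∑ s ∈ Finset.Ico 2 s₀, ((s : ℕ) : ℝ) ^ 2 * μN s ≤ B₁N)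
    (hlam : 0 < lam) (hlamT : lam + (B₁T + tailConst (1 / 40) / (3 * (((s₀ : ℕ) : ℝ) - 1) ^ 3)) ≤ lT)
    (hlamN : lam + (B₁N + tailConst (1 / 40) / (3 * (((s₀ : ℕ) : ℝ) - 1) ^ 3)) ≤ lN) : TubeConvexRef (17 / 16) (1 / 40) :=
  tubeConvexRef_record_of_certs hA hB (powerPairModulusRef_of_le le_rfl (by norm_num)) (tailConst_nonneg _) hs₀ hμT hμN h₁T h₁N hlam
    hlamT hlamN

section Cones

open Summit.AtomisticToContinuum.Crystallization.Theses.OverbindingBudget (RobustDefectLimitWindows)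
open Summit.AtomisticToContinuum.Crystallization.Theses.PricedLinkCensus (ChargedEnergyGap)
open Summit.AtomisticToContinuum.Crystallization.Theorems.OverbindingBudgetGradedBareness (CleanlessExcessT)
open Summit.AtomisticToContinuum.Crystallization.Theorems.OverbindingBudgetCoherentCut (CoherentResidual)
open Summit.AtomisticToContinuum.Crystallization.Theorems.OverbindingBudgetUniformCutStatements (GrossCleanBallsU)
open Summit.AtomisticToContinuum.Crystallization.Theorems.OverbindingBudgetElasticSplitScale (CompressedVirialLaw)
open Summit.AtomisticToContinuum.Crystallization.Theorems.OverbindingBudgetScaleWidening (DoorPeriodicW)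
open Summit.AtomisticToContinuum.Crystallization.Theorems.OverbindingBudgetTwoShellShape (TwoShellShape BarlowGluingW)
open Summit.AtomisticToContinuum.Crystallization.Theorems.OverbindingBudgetStackedRigidityW (StackedReductionW GapStressVanishesW
  BasalReferenceW)
open Summit.AtomisticToContinuum.Crystallization.Theorems.OverbindingBudgetStackedRigidityRef (RegistryPinningW BasalReferenceCW)
open Summit.AtomisticToContinuum.Crystallization.Theorems.ChartedPlanarOrderTubeConvex (rdef_of_grossU_shape_gluing_pinning_convexW'
  rdef_of_grossU_shape_gluing_pinning_convexRef)

/-- ★ the RDEF cone OF RECORD `(2, 17/16; 1/40, 3/16)` with slot 7 = the TWO W′ certificate leaves + a power constant `K` + arithmetic. -/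
theorem rdef_of_grossU_shape_gluing_pinning_certs_record {lT lN lam B₁T B₁N K : ℝ} {μT μN : ℕ → ℝ} {s₀ : ℕ}
    (hG : GrossCleanBallsU (1 / 250) 10) (hCEG : ChargedEnergyGap) (hC : CompressedVirialLaw (1 / 250) 10)
    (hS : TwoShellShape (1 / 100) (3 / 50) (1 / 450)) (hB₂ : BarlowGluingW) (hD : DoorPeriodicW 2) (hSR : StackedReductionW 2 (17 / 16))
    (hV : GapStressVanishesW (17 / 16)) (hPin : RegistryPinningW (17 / 16) (1 / 40) (3 / 16))
    (hA : AdjacentChannelW' (17 / 16) (1 / 40) lT lN) (hB : FarChannelBelowW' (17 / 16) (1 / 40) μT μN s₀)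
    (hP : PowerPairModulusW' (17 / 16) (1 / 40) K) (hK : 0 ≤ K) (hs₀ : 2 ≤ s₀) (hμT : ∀ s, 0 ≤ μT s) (hμN : ∀ s, 0 ≤ μN s)
    (h₁T : ∑ s ∈ Finset.Ico 2 s₀, ((s : ℕ) : ℝ) ^ 2 * μT s ≤ B₁T) (h₁N : ∑ s ∈ Finset.Ico 2 s₀, ((s : ℕ) : ℝ) ^ 2 * μN s ≤ B₁N)
    (hlam : 0 < lam) (hlamT : lam + (B₁T + K / (3 * (((s₀ : ℕ) : ℝ) - 1) ^ 3)) ≤ lT)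
    (hlamN : lam + (B₁N + K / (3 * (((s₀ : ℕ) : ℝ) - 1) ^ 3)) ≤ lN)
    (hRef : BasalReferenceW (17 / 16) (3 / 16)) (hCE : CleanlessExcessT) (hRes : CoherentResidual 10) : RobustDefectLimitWindows :=
  rdef_of_grossU_shape_gluing_pinning_convexW' 2 (17 / 16) (1 / 40) (3 / 16) hG hCEG hC hS hB₂ hD hSR hV hPin
    (tubeConvexW'_record_of_certs hA hB hP hK hs₀ hμT hμN h₁T h₁N hlam hlamT hlamN) hRef hCE hRes

/-- ★ the Ref-currency RDEF cone `(2, 17/16; 1/40, 3/16)` with slot 7 = the TWO Ref certificate leaves + a power constant `K` + arithmetic. -/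
theorem rdef_of_grossU_shape_gluing_pinning_certsRef_record {lT lN lam B₁T B₁N K : ℝ} {μT μN : ℕ → ℝ} {s₀ : ℕ}
    (hG : GrossCleanBallsU (1 / 250) 10) (hCEG : ChargedEnergyGap) (hC : CompressedVirialLaw (1 / 250) 10)
    (hS : TwoShellShape (1 / 100) (3 / 50) (1 / 450)) (hB₂ : BarlowGluingW) (hD : DoorPeriodicW 2) (hSR : StackedReductionW 2 (17 / 16))
    (hV : GapStressVanishesW (17 / 16)) (hPin : RegistryPinningW (17 / 16) (1 / 40) (3 / 16))
    (hA : AdjacentChannelRef (17 / 16) (1 / 40) lT lN) (hB : FarChannelBelowRef (17 / 16) (1 / 40) μT μN s₀)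
    (hP : PowerPairModulusRef (17 / 16) (1 / 40) K) (hK : 0 ≤ K) (hs₀ : 2 ≤ s₀) (hμT : ∀ s, 0 ≤ μT s) (hμN : ∀ s, 0 ≤ μN s)
    (h₁T : ∑ s ∈ Finset.Ico 2 s₀, ((s : ℕ) : ℝ) ^ 2 * μT s ≤ B₁T) (h₁N : ∑ s ∈ Finset.Ico 2 s₀, ((s : ℕ) : ℝ) ^ 2 * μN s ≤ B₁N)
    (hlam : 0 < lam) (hlamT : lam + (B₁T + K / (3 * (((s₀ : ℕ) : ℝ) - 1) ^ 3)) ≤ lT)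
    (hlamN : lam + (B₁N + K / (3 * (((s₀ : ℕ) : ℝ) - 1) ^ 3)) ≤ lN)
    (hRef : BasalReferenceCW (17 / 16) (3 / 16)) (hCE : CleanlessExcessT) (hRes : CoherentResidual 10) : RobustDefectLimitWindows :=
  rdef_of_grossU_shape_gluing_pinning_convexRef 2 (17 / 16) (1 / 40) (3 / 16) hG hCEG hC hS hB₂ hD hSR hV hPin
    (tubeConvexRef_record_of_certs hA hB hP hK hs₀ hμT hμN h₁T h₁N hlam hlamT hlamN) hRef hCE hRes

end Cones

end Summit.AtomisticToContinuum.Crystallization.Theorems.ChartedPlanarOrderPairModulusTail
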